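import Literature.Topology.PlaneTopology.StripCrossings
import Mathlib.Topology.UniformSpace.HeineCantor
import HarnessLib

/-!
# Two continua in plus position must meet; charts and their room

Topic: Topology / PlaneTopology.  The planar lemma behind "an open path and a closed (dual) path
cannot cross" arguments in plus position (Bollobás–Riordan, *Percolation* (2006), Ch. 7, proof of
Claim 19, p. 192: a horizontal crossing of a rectangle meets every vertical crossing; Newman,
*Elements of the topology of plane sets of points* (1939), Ch. V §11; Schramm–Smirnov, Ann. Probab.
39 (2011), §1.3), in the continuum form used for drawn lattice paths, complementing
`RectangleDuality.lean` (continuum versus path) and `StripCrossings.lean`: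

* `inter_nonempty_of_crossing_continua` — **two continua crossing a rectangle meet**: a compact
  connected `K ⊆ [a, b] × [c, d]` meeting both vertical sides and a compact connected
  `L ⊆ [a, b] × [c, d]` meeting both horizontal sides intersect (thicken `L`, join its two side
  points by a path in the thickening, clamp it into the rectangle and apply the continuum-versus-path
  lemma `exists_mem_of_isPreconnected_crossing`).
* `exists_subcontinuum_between_hlines` — the horizontal-band version of
  `exists_subcontinuum_between_lines` (transport by the swap `z ↦ im z + re z · i`).
* `inter_nonempty_of_plus` — **plus position**: a compact connected `V` inside the vertical strip
  `a ≤ re ≤ b` meeting `{im ≤ c}` and `{d ≤ im}`, and a compact connected `H` inside the horizontal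
  band `c ≤ im ≤ d` meeting `{re ≤ a}` and `{b ≤ re}`, intersect (clip both to the rectangle).
* `inter_nonempty_of_plus_chart` — the same read through a homeomorphism `Φ : ℂ ≃ₜ ℂ` of the plane
  (conditions on `Φ.symm p`), the form used for plate crossings of the images of rectangles.
* `exists_chart_room` — **room of a chart**: for `Φ : ℂ ≃ₜ ℂ`, a compact `K` and `ν > 0` there is
  `ρ > 0` such that every point within `ρ` of `Φ z`, `z ∈ K`, pulls back to within `ν` of `z`
  (uniform continuity of `Φ⁻¹` on a compact neighbourhood of `Φ(K)`).

## References

* B. Bollobás, O. Riordan, *Percolation*, CUP (2006), Ch. 7, Claim 19 p. 192. [BollobasRiordan2006]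
* M. H. A. Newman, *Elements of the topology of plane sets of points* (1939), Ch. V §11. [Newman1939]
* O. Schramm, S. Smirnov, Ann. Probab. 39 (2011), §1.3. [SchrammSmirnov2011]
-/

noncomputable section

namespace Literature.Topology.PlaneTopology

open Complex Set Metric Filter Function _root_.Topology

variable {a b c d : ℝ}

/-! ### Two continua crossing a rectangle in complementary directions meet -/

/-- **Two crossing continua of a rectangle meet.**  Let `K, L ⊆ [a, b] × [c, d]` be compact and
connected, `K` meeting the left side `re = a` and the right side `re = b`, `L` meeting the bottom
side `im = c` and the top side `im = d`.  Then `K ∩ L ≠ ∅`.  (If they were disjoint they would have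
disjoint `ε`-thickenings; join the two side points of `L` by a path in the thickening of `L`,
clamp it into the rectangle by the `1`-Lipschitz retraction — which fixes `L` — and apply the
continuum-versus-path crossing lemma to `K` and this path.)
[cite: BollobasRiordan2006, Ch. 7 Claim 19 p. 192] -/
theorem inter_nonempty_of_crossing_continua {K L : Set ℂ} (hab : a ≤ b) (hcd : c ≤ d)
    (hK : IsCompact K) (hKc : IsPreconnected K) (hKsub : K ⊆ Icc a b ×ℂ Icc c d)
    (hKa : ∃ z ∈ K, z.re = a) (hKb : ∃ z ∈ K, z.re = b)
    (hL : IsCompact L) (hLc : IsPreconnected L) (hLsub : L ⊆ Icc a b ×ℂ Icc c d)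
    (hLc' : ∃ z ∈ L, z.im = c) (hLd : ∃ z ∈ L, z.im = d) : (K ∩ L).Nonempty := by
  by_contra hKL
  have hdisj : Disjoint K L := disjoint_iff_inter_eq_empty.2 (not_nonempty_iff_eq_empty.1 hKL)
  obtain ⟨ε, hε, hthick⟩ := hdisj.exists_thickenings hK hL.isClosed
  obtain ⟨zc, hzc, hzcim⟩ := hLc'
  obtain ⟨zd, hzd, hzdim⟩ := hLd
  obtain ⟨γ₀, hγ₀⟩ : JoinedIn (thickening ε L) zc zd :=
    joinedIn_of_isPreconnected isOpen_thickening hLc (self_subset_thickening hε L) hzc hzd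
  obtain ⟨ρ, hρc, hρmem, hρid, hρlip⟩ := exists_retraction_reProdIm hab hcd
  set β : ℝ → ℂ := fun s => ρ (γ₀.extend s) with hβ
  have hβc : Continuous β := hρc.comp γ₀.continuous_extend
  have hβ0 : (β 0).im = c := by
    simp only [hβ, Path.extend_zero]
    rw [hρid zc (hLsub hzc), hzcim]
  have hβ1 : (β 1).im = d := by
    simp only [hβ, Path.extend_one]
    rw [hρid zd (hLsub hzd), hzdim]
  obtain ⟨t, ht, hβt⟩ := exists_mem_of_isPreconnected_crossing hab hcd hK hKc hKsub hKa hKb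
    hβc.continuousOn (fun s _ => hρmem _) hβ0 hβ1
  have hβtL : β t ∈ thickening ε L := by
    have hmem : γ₀.extend t ∈ thickening ε L := by
      rw [Path.extend_apply γ₀ ht]
      exact hγ₀ _
    obtain ⟨k, hk, hdist⟩ := mem_thickening_iff.1 hmem
    refine mem_thickening_iff.2 ⟨k, hk, ?_⟩
    calc dist (β t) k = dist (ρ (γ₀.extend t)) (ρ k) := by rw [hρid k (hLsub hk)]
      _ ≤ dist (γ₀.extend t) k := hρlip _ _
      _ < ε := hdist
  exact Set.disjoint_left.1 hthick (self_subset_thickening hε K hβt) hβtL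

/-! ### Sub-continuum inside a horizontal band -/

/-- The swap `z ↦ im z + re z · i` of the two coordinates (reflection in the diagonal). [folklore] -/
theorem continuous_swap : Continuous fun z : ℂ => (⟨z.im, z.re⟩ : ℂ) := by
  have h : (fun z : ℂ => (⟨z.im, z.re⟩ : ℂ)) =
      ⇑Complex.equivRealProdCLM.symm ∘ fun z : ℂ => (z.im, z.re) := by
    funext z
    apply Complex.ext <;> simp [Complex.equivRealProdCLM_symm_apply]
  rw [h]
  exact Complex.equivRealProdCLM.symm.continuous.comp (continuous_im.prodMk continuous_re)

/-- **Sub-continuum inside a horizontal band.**  If a compact connected `K ⊆ ℂ` meets `{im ≤ c}`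
and `{d ≤ im}` (`c ≤ d`), then some compact connected `K' ⊆ K` lies in the closed band
`{c ≤ im ≤ d}` and meets both lines `im = c` and `im = d` (`exists_subcontinuum_between_lines`
transported by the swap of coordinates). [folklore] -/
theorem exists_subcontinuum_between_hlines {K : Set ℂ} (hcd : c ≤ d)
    (hK : IsCompact K) (hKc : IsPreconnected K) (hKa : ∃ z ∈ K, z.im ≤ c)
    (hKb : ∃ z ∈ K, d ≤ z.im) :
    ∃ K' ⊆ K, IsCompact K' ∧ IsPreconnected K' ∧ (∀ z ∈ K', c ≤ z.im ∧ z.im ≤ d) ∧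
      (∃ z ∈ K', z.im = c) ∧ ∃ z ∈ K', z.im = d := by
  set σ : ℂ → ℂ := fun z => (⟨z.im, z.re⟩ : ℂ) with hσ
  have hσc : Continuous σ := continuous_swap
  have hσσ : ∀ z, σ (σ z) = z := fun z => rfl
  obtain ⟨za, hza, hzaim⟩ := hKa
  obtain ⟨zb, hzb, hzbim⟩ := hKb
  obtain ⟨K₁, hK₁sub, hK₁c, hK₁p, hK₁band, ⟨u, hu, hure⟩, ⟨v, hv, hvre⟩⟩ :=
    exists_subcontinuum_between_lines (K := σ '' K) hcd (hK.image hσc) (hKc.image _ hσc.continuousOn)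
      ⟨σ za, mem_image_of_mem _ hza, hzaim⟩ ⟨σ zb, mem_image_of_mem _ hzb, hzbim⟩
  have hback : σ '' K₁ ⊆ K := by
    rintro _ ⟨w, hw, rfl⟩
    obtain ⟨z, hz, rfl⟩ := hK₁sub hw
    rwa [hσσ]
  refine ⟨σ '' K₁, hback, hK₁c.image hσc, hK₁p.image _ hσc.continuousOn, ?_, ?_, ?_⟩
  · rintro _ ⟨w, hw, rfl⟩
    exact hK₁band w hw
  · exact ⟨σ u, mem_image_of_mem _ hu, hure⟩
  · exact ⟨σ v, mem_image_of_mem _ hv, hvre⟩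

/-! ### Plus position -/

/-- **Two continua in plus position meet.**  Let `V` be compact and connected inside the vertical
strip `a ≤ re ≤ b`, meeting `{im ≤ c}` and `{d ≤ im}`, and let `H` be compact and connected inside
the horizontal band `c ≤ im ≤ d`, meeting `{re ≤ a}` and `{b ≤ re}` (`a ≤ b`, `c ≤ d`).  Then
`V ∩ H ≠ ∅`: clip `V` to the band and `H` to the strip (`exists_subcontinuum_between_hlines`,
`exists_subcontinuum_between_lines`) and apply `inter_nonempty_of_crossing_continua` in the
rectangle `[a, b] × [c, d]`.  (Bollobás–Riordan: "a horizontal crossing and a vertical crossing of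
the same rectangle must meet".) [cite: BollobasRiordan2006, Ch. 7 Claim 19 p. 192] -/
theorem inter_nonempty_of_plus {V H : Set ℂ} (hab : a ≤ b) (hcd : c ≤ d)
    (hV : IsCompact V) (hVc : IsPreconnected V) (hVstrip : ∀ z ∈ V, a ≤ z.re ∧ z.re ≤ b)
    (hVc' : ∃ z ∈ V, z.im ≤ c) (hVd : ∃ z ∈ V, d ≤ z.im)
    (hH : IsCompact H) (hHc : IsPreconnected H) (hHband : ∀ z ∈ H, c ≤ z.im ∧ z.im ≤ d)
    (hHa : ∃ z ∈ H, z.re ≤ a) (hHb : ∃ z ∈ H, b ≤ z.re) : (V ∩ H).Nonempty := by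
  obtain ⟨V', hV'sub, hV'c, hV'p, hV'band, hV'c', hV'd⟩ :=
    exists_subcontinuum_between_hlines hcd hV hVc hVc' hVd
  obtain ⟨H', hH'sub, hH'c, hH'p, hH'strip, hH'a, hH'b⟩ :=
    exists_subcontinuum_between_lines hab hH hHc hHa hHb
  have hV'R : V' ⊆ Icc a b ×ℂ Icc c d := fun z hz =>
    mem_reProdIm.2 ⟨hVstrip z (hV'sub hz), hV'band z hz⟩
  have hH'R : H' ⊆ Icc a b ×ℂ Icc c d := fun z hz =>
    mem_reProdIm.2 ⟨hH'strip z hz, hHband z (hH'sub hz)⟩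
  obtain ⟨z, hzH, hzV⟩ := inter_nonempty_of_crossing_continua hab hcd hH'c hH'p hH'R hH'a hH'b
    hV'c hV'p hV'R hV'c' hV'd
  exact ⟨z, hV'sub hzV, hH'sub hzH⟩

/-- **Plus position in a chart.**  For a homeomorphism `Φ` of the plane, a compact connected `V`
whose pull-back `Φ⁻¹(V)` lies in the strip `a ≤ re ≤ b` and meets `{im ≤ c}` and `{d ≤ im}`,
and a compact connected `H` whose pull-back lies in the band `c ≤ im ≤ d` and meets `{re ≤ a}`
and `{b ≤ re}`, intersect (`inter_nonempty_of_plus` for `Φ⁻¹(V)`, `Φ⁻¹(H)` and injectivity of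
`Φ⁻¹`). [cite: BollobasRiordan2006, Ch. 7 Claim 19 p. 192] -/
theorem inter_nonempty_of_plus_chart (Φ : ℂ ≃ₜ ℂ) {V H : Set ℂ} (hab : a ≤ b) (hcd : c ≤ d)
    (hV : IsCompact V) (hVc : IsPreconnected V)
    (hVstrip : ∀ p ∈ V, a ≤ (Φ.symm p).re ∧ (Φ.symm p).re ≤ b)
    (hVc' : ∃ p ∈ V, (Φ.symm p).im ≤ c) (hVd : ∃ p ∈ V, d ≤ (Φ.symm p).im)
    (hH : IsCompact H) (hHc : IsPreconnected H)
    (hHband : ∀ p ∈ H, c ≤ (Φ.symm p).im ∧ (Φ.symm p).im ≤ d)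
    (hHa : ∃ p ∈ H, (Φ.symm p).re ≤ a) (hHb : ∃ p ∈ H, b ≤ (Φ.symm p).re) :
    (V ∩ H).Nonempty := by
  have hc : Continuous Φ.symm := Φ.symm.continuous
  obtain ⟨z, ⟨p, hpV, rfl⟩, ⟨q, hqH, hpq⟩⟩ := inter_nonempty_of_plus (V := Φ.symm '' V)
    (H := Φ.symm '' H) hab hcd (hV.image hc) (hVc.image _ hc.continuousOn)
    (by rintro _ ⟨p, hp, rfl⟩; exact hVstrip p hp)
    (by obtain ⟨p, hp, h⟩ := hVc'; exact ⟨_, mem_image_of_mem _ hp, h⟩)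
    (by obtain ⟨p, hp, h⟩ := hVd; exact ⟨_, mem_image_of_mem _ hp, h⟩)
    (hH.image hc) (hHc.image _ hc.continuousOn)
    (by rintro _ ⟨p, hp, rfl⟩; exact hHband p hp)
    (by obtain ⟨p, hp, h⟩ := hHa; exact ⟨_, mem_image_of_mem _ hp, h⟩)
    (by obtain ⟨p, hp, h⟩ := hHb; exact ⟨_, mem_image_of_mem _ hp, h⟩)
  exact ⟨p, hpV, Φ.symm.injective hpq ▸ hqH⟩

/-! ### Room of a chart -/

/-- **Room of a chart.**  For a homeomorphism `Φ` of the plane, a compact `K ⊆ ℂ` and `ν > 0`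
there is `ρ > 0` such that for all `z ∈ K` and all `p` with `dist p (Φ z) ≤ ρ` one has
`dist (Φ⁻¹ p) z ≤ ν`: `Φ⁻¹` is uniformly continuous on the compact neighbourhood
`cthickening 1 (Φ(K))` (Heine–Cantor). Used to compare lattice paths drawn at mesh `δ ≤ ρ` near
`Φ(K)` with the model coordinates. [folklore] -/
theorem exists_chart_room (Φ : ℂ ≃ₜ ℂ) {K : Set ℂ} (hK : IsCompact K) {ν : ℝ} (hν : 0 < ν) :
    ∃ ρ : ℝ, 0 < ρ ∧ ∀ z ∈ K, ∀ p : ℂ, dist p (Φ z) ≤ ρ → dist (Φ.symm p) z ≤ ν := by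
  set C : Set ℂ := cthickening 1 (Φ '' K) with hC
  have hCc : IsCompact C := (hK.image Φ.continuous).cthickening
  have huc : UniformContinuousOn Φ.symm C :=
    hCc.uniformContinuousOn_of_continuous Φ.symm.continuous.continuousOn
  obtain ⟨η, hη, h⟩ := Metric.uniformContinuousOn_iff_le.1 huc ν hν
  refine ⟨min η 1, lt_min hη one_pos, fun z hz p hp => ?_⟩
  have hΦz : Φ z ∈ C := self_subset_cthickening _ (mem_image_of_mem _ hz)
  have hpC : p ∈ C := by
    refine mem_cthickening_of_dist_le p (Φ z) 1 _ (mem_image_of_mem _ hz) ?_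
    exact hp.trans (min_le_right _ _)
  have := h p hpC (Φ z) hΦz (hp.trans (min_le_left _ _))
  rwa [Homeomorph.symm_apply_apply] at this

end Literature.Topology.PlaneTopology
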